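import Mathlib
import Literature.NumberTheory.LFunctions.Zhang2022.Section4Step4u050
import Literature.NumberTheory.LFunctions.Zhang2022.Section4Eq410Wide
import Literature.NumberTheory.LFunctions.Zhang2022.Section4Lemma43Edge
import Literature.NumberTheory.LFunctions.Zhang2022.Section4Lemma41
import Literature.NumberTheory.LFunctions.Zhang2022.Section4Lemma42Holds
import Literature.NumberTheory.LFunctions.Zhang2022.Section4Eq46Holds
import HarnessLib

/-!
# Zhang (2022), §4: (4.12) on the WHOLE disc `|w| < 2α` from (4.10) on the wide strip `Ω₃′`

Topic `Literature/NumberTheory/LFunctions/Zhang2022` (Landau–Siegel audit tree; verdict-neutral).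
Y. Zhang, *Discrete mean estimates and the Landau–Siegel zero*, arXiv:2211.02515v1 (2022)
[Zhang2022LandauSiegel] — **an unrefereed manuscript under adjudication; nothing here asserts or
denies its Theorems 1–2.** Campaign D-0069, layer L1, row t7 (§4 pp. 21–23), kernel EDGES only
(no new definitions, no new facts).

The proof of (4.12) [Z22 p.22, tex L1227–L1229] opens with "Assume `|w| < 2α`. By (4.10) we have
`𝒜(1/2+iγ+w,ψ) − (1−P^{−2w}) = ℬ(1/2+iγ+w,ψ) + P^{−2w} + O(𝓛⁻¹⁰⁰)`" (display `Z22:§4.u049`,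
typed as `Section4.Step4u049`). The point `1/2+iγ+w` has real part in `(1/2 − 2α, 1/2 + 2α)`, while
(4.10) is STATED on `Ω₃ = {1/2 − α < σ < 1 + α, …}` [Z22 p.21, tex L1139–L1145]; the tree's
`Section4.step4u049_inner_of_eq410` therefore reaches only `Re w > −α` (GAP row G-L1t7-1, in-cone /
cosmetic). With (4.10) on the wide strip `Ω₃′ = {1/2 − 3α < σ < 1 + α, |t − 2πt₀| < 𝓛₁ + 3}` —
the row's wanted statement `Skeleton.Eq410Wide` (module `Section4Eq410Wide`, itself reduced there to
Lemma 4.4 on `Ω₃′`, `Skeleton.Lemma44Wide`, by `Skeleton.eq410Wide_of`) — the display holds on the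
whole disc, and the already-landed deduction `Section4.dedEq412_holds : Step4u049 → Step4u050 →
Lem46CalBAtZero → Eq412` closes (4.12) in full:

* `step4u049_of_eq410Wide : Skeleton.Eq410Wide → Step4u049` — `Z22:§4.u049` on all of `|w| < 2α`;
* `eq412_of_eq410Wide : Lemma42 → Lemma43 → Eq46 → Eq410Wide → Eq412` — (4.12), with
  `Z22:§4.u050` from `Section4.step4u050_of` and "`ℬ(ρ) = −1 + O(𝓛⁻¹⁰⁰)`" from
  `Section4.lem46CalBAtZero_of_eq410 ∘ Skeleton.eq410_of_eq410Wide`;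
* `eq412_of_lemma44Wide : Skeleton.Lemma44Wide → Eq412` — feeding the landed `lemma41_holds`,
  `lemma42_holds`, `lemma43_of`, `Section4.eq46_holds`: **(4.12) hangs on the single claim
  "Lemma 4.4 on `Ω₃′`"**;
* `step4u048_of_lemma44Wide` — hence the Rouché hypothesis `Z22:§4.u048` for every `c′` beyond a
  threshold (`Section4.step4u048_of_eq412`).

Downstream (not restated here): the tree's `Section4.lemma47_of_rouche` / `prop22iii_of_rouche`
take `Eq412` as their analytic input, so Lemma 4.7 and Prop. 2.2 (iii) follow from `Lemma44Wide`
and the Rouché count (tree theorem `Literature.Analysis.Complex.Rouche.*`).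

WHAT THIS IS NOT: a proof of Lemma 4.4 on either strip, or any statement about Theorems 1–2 /
Landau–Siegel zeros.

## References

* Y. Zhang, arXiv:2211.02515v1 (2022), §4: (4.10) p. 21, Lemma 4.6 and the proof of (4.12)
  pp. 22–23, Lemma 4.7 p. 23. [cite: Zhang2022LandauSiegel, §4 (4.12) pp.22–23]
-/

noncomputable section

open Complex Real

namespace Literature.NumberTheory.LFunctions.Zhang2022.Section4

open Literature.NumberTheory.LFunctions.Zhang2022.Skeleton

/-- **Display `Z22:§4.u049` on the WHOLE disc `|w| < 2α`, from (4.10) on `Ω₃′`** (kernel EDGE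
`Skeleton.Eq410Wide → Step4u049`): for `ρ = β + iγ` in Lemma 4.6's region and `|w| < 2α` the point
`1/2 + iγ + w` has `1/2 − 3α < 1/2 − 2α < σ < 1/2 + 2α < 1 + α` and height within `𝓛₁ + 2 + 2α <
𝓛₁ + 3` of `2πt₀` (`α = π𝓛⁻⁹ ≤ 1/2` once `𝓛 ≥ 3`), i.e. it lies in `Ω₃′`, where the wide (4.10) gives
`𝒜 − 1 − ℬ = O(𝓛⁻¹⁰⁰)`; and `𝒜 − (1 − P^{−2w}) − (ℬ + P^{−2w}) = 𝒜 − 1 − ℬ` identically.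
[cite: Zhang2022LandauSiegel, Lemma 4.6 (proof) p.22] -/
theorem step4u049_of_eq410Wide (h : Eq410Wide) : Step4u049 := by
  obtain ⟨C, D₀, hC⟩ := h
  refine ⟨C, max D₀ ⌈Real.exp 3⌉₊, fun D _ χ hD hq hp x hx ρ hρ _ w hw => ?_⟩
  have hℓ3 : 3 ≤ ell D := three_le_ell_of_le (le_trans (le_max_right _ _) hD)
  have hℓ0 : 0 < ell D := by linarith
  have hαpos : 0 < alpha D := by
    rw [Section2.alpha_eq_pi_div_ell9]; exact div_pos Real.pi_pos (pow_pos hℓ0 9)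
  have hαsmall : alpha D ≤ 1 / 2 := by
    have h9 : (3 : ℝ) ^ 9 ≤ ell D ^ 9 := by gcongr
    rw [Section2.alpha_eq_pi_div_ell9, div_le_iff₀ (pow_pos hℓ0 9)]
    nlinarith [Real.pi_lt_four, h9]
  obtain ⟨_, _, hγ⟩ := hρ
  have hwre2 : |w.re| < 2 * alpha D := lt_of_le_of_lt (abs_re_le_norm w) hw
  have hwim2 : |w.im| < 2 * alpha D := lt_of_le_of_lt (abs_im_le_norm w) hw
  obtain ⟨hwre1, hwre1'⟩ := abs_lt.mp hwre2
  obtain ⟨hwim1, hwim1'⟩ := abs_lt.mp hwim2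
  obtain ⟨hγ1, hγ2⟩ := abs_lt.mp hγ
  have hre : ((1 / 2 : ℂ) + ρ.im * I + w).re = 1 / 2 + w.re := by simp
  have him : ((1 / 2 : ℂ) + ρ.im * I + w).im = ρ.im + w.im := by simp
  have h1 : 1 / 2 - 3 * alpha D < ((1 / 2 : ℂ) + ρ.im * I + w).re := by rw [hre]; linarith
  have h2 : ((1 / 2 : ℂ) + ρ.im * I + w).re < 1 + alpha D := by rw [hre]; linarith
  have h3 : |((1 / 2 : ℂ) + ρ.im * I + w).im - 2 * π * t0 D| < ell1 D + 3 := by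
    rw [him, abs_lt]; constructor <;> linarith
  have h410 := hC D χ (le_trans (le_max_left _ _) hD) hq hp x hx _ h1 h2 h3
  have heq : (calA χ x (1 / 2 + ρ.im * I + w) - (1 - Pm2w D w))
      - (calB χ x (1 / 2 + ρ.im * I + w) + Pm2w D w)
      = calA χ x (1 / 2 + ρ.im * I + w) - 1 - calB χ x (1 / 2 + ρ.im * I + w) := by ring
  rw [heq]
  exact h410

/-- **(4.12) on the whole disc `|w| < 2α` from Lemmas 4.2, 4.3, (4.6) and (4.10) on `Ω₃′`**
(kernel EDGE, the manuscript's proof of (4.12) pp. 22–23 assembled: `Z22:§4.u049` from the wide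
(4.10), `Z22:§4.u050` = `Section4.step4u050_of` (Lemma 4.2, Lemma 4.3, (4.6)),
"`ℬ(ρ) = −1 + O(𝓛⁻¹⁰⁰)`" from (4.10) at `ρ ∈ Ω₃ ⊆ Ω₃′`, and the landed assembly
`Section4.dedEq412_holds`). [cite: Zhang2022LandauSiegel, (4.12) pp.22–23] -/
theorem eq412_of_eq410Wide (h42 : Lemma42) (h43 : Lemma43) (h46 : Eq46) (hW : Eq410Wide) :
    Eq412 :=
  dedEq412_holds (step4u049_of_eq410Wide hW) (step4u050_of h42 h43 h46)
    (lem46CalBAtZero_of_eq410 (eq410_of_eq410Wide hW))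

/-- **(4.12) from the single claim "Lemma 4.4 on `Ω₃′`"** (`Skeleton.Lemma44Wide`, GAP row
G-L1t7-1's analytic residue): Lemmas 4.1 and 4.2 are tree theorems (`lemma41_holds`,
`lemma42_holds`), Lemma 4.3 follows from them (`lemma43_of`), (4.6) is a tree theorem
(`Section4.eq46_holds`), and (4.10) on `Ω₃′` follows from Lemma 4.4 on `Ω₃′` (`eq410Wide_of`).
[cite: Zhang2022LandauSiegel, (4.12) pp.22–23] -/
theorem eq412_of_lemma44Wide (h44 : Lemma44Wide) : Eq412 :=
  eq412_of_eq410Wide lemma42_holds (lemma43_of lemma41_holds lemma42_holds) eq46_holds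
    (eq410Wide_of lemma41_holds lemma42_holds h44)

/-- **The Rouché hypothesis `Z22:§4.u048` of Lemma 4.6, for every `c′` beyond a threshold, from
"Lemma 4.4 on `Ω₃′`"** ((4.12) by `eq412_of_lemma44Wide`, then (4.13): `Section4.step4u048_of_eq412`).
[cite: Zhang2022LandauSiegel, Lemma 4.6 (proof) p.22] -/
theorem step4u048_of_lemma44Wide (h44 : Lemma44Wide) :
    ∃ c₀ : ℝ, ∀ c' : ℝ, c₀ < c' → Step4u048 c' :=
  step4u048_of_eq412 (eq412_of_lemma44Wide h44)

end Literature.NumberTheory.LFunctions.Zhang2022.Section4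

end
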